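import Summits.BirchSwinnertonDyer.BirchSwinnertonDyer.Theorems.ByReductionTypeAtTwoFineSelmerConjAAtTwoAdditivePotGoodClassNumberOneCriterion
import Literature.NumberTheory.NumberFields.CubicFieldExplicit
import HarnessLib

/-!
# Route `ByReductionTypeAtTwo` (rung K4), crux C1″ `FineSelmerConjAAtTwoAdditivePotGood` (item stmt-BirchSwinnertonDyer-22615):
# THE CLASS-NUMBER-ONE CRITERION WITH FRACTIONAL WITNESSES — generators `(x + yθ + zθ²)/m ∈ 𝓞 K` of the primes of small norm, and
# second generators `θ' = (x + yθ + zθ²)/m` for the primes dividing the index of `ℤ[θ]`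
# (a `--supports 22615` toolkit file; seat `bsd-2adic-k4-w1` GEN 6; sequel of `…ClassNumberOneCriterion`)

HONEST FRAMING (cell `bsd-2adic`, D-0036/D-0054): UNCONDITIONAL kernel lemmas about cubic number fields; closes nothing; nothing booked;
BSD is not proved by any of this.

WHY (found while certifying the census fields, GEN 6): for a NON-monogenic cubic field a principal prime `P` of `𝓞 K` need not have a
generator inside the order `ℤ[θ]`, even when `N(P)` is prime to the index `[𝓞 K : ℤ[θ]]` — the obstruction is the class of `P ∩ ℤ[θ]` in
the Picard group of the order (ring class group), which can be strictly bigger than `Cl(𝓞 K)`. Example: `θ³ + 16θ − 28 = 0` (`d_K = −9388`,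
index `2`, `h_K = 1`): the primes above `13, 17, 23` with `θ ≡ 9, 11, 16` have no norm-`ℓ` element in `ℤ[θ]`. So the certificates of
`…ClassNumberOneCriterion` are extended to witnesses `ω = (x + yθ + zθ²)/m ∈ 𝓞 K` with `m` prime to `ℓ`:

* `classNumber_eq_one_of_prime_norm_principal` — the criterion with the per-prime hypothesis «every ideal of norm `ℓ` is principal»
  left abstract (so that different primes may be certified with different generators `θ`, `θ'` of `𝓞 K`).
* `exists_intElem_of_scaled_cubic` — an element `ω ∈ 𝓞 K` with `m ω = x + yθ + zθ²` and `ω³ + c₂ω² + c₁ω + c₀ = 0`, from the single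
  identity `T³ + m c₂ T² + m² c₁ T + m³ c₀ = 0` for `T = x + yθ + zθ²` (checked per field by `linear_combination`). This constructs both the
  fractional witnesses and the second generators.
* `isPrincipal_of_absNorm_eq_prime_frac` — every ideal of prime norm `ℓ` is principal, given for each root `a` of the cubic mod `ℓ` a
  fractional witness: `m` coprime to `ℓ`, `ℓ ∣ x + ya + za²`, `ω ∈ 𝓞 K` with `m ω = x + yθ + zθ²`, `|normPoly(x, y, z)| = m³ ℓ`
  (`I` is prime as `N(I)` is, `mω ∈ I`, `m ∉ I` ⟹ `ω ∈ I`; `N(mω) = m³ N(ω)`).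

References: [Marcus1977] Ch. 5 Thm. 35–37; [Cohen1993] §4.8.2, §6.3; [Neukirch1999] I.§12 (orders, conductor, Picard group).
-/

set_option autoImplicit false
-- sibling precedent (`…ClassNumberOneCriterion.lean`): the directory name repeats the summit name
set_option linter.dupNamespace false

noncomputable section

open scoped Classical IntermediateField NumberField Real nonZeroDivisors

namespace Summit.BirchSwinnertonDyer.BirchSwinnertonDyer.Theorems.AddKatoTwo

open Polynomial IsDedekindDomain NumberField Matrix

variable (K : Type) [Field K] [NumberField K]

/-! ## §1 The criterion with an abstract per-prime hypothesis -/

/-- **`h_K = 1` as soon as `M_K < B` and every ideal of prime norm `ℓ < B` is principal** (cubic `K`): a prime `P` with `N(P) ≤ M_K` lies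
over some `ℓ < B` with `N(P) ∈ {ℓ, ℓ², ℓ³}`; `N = ℓ²` reduces to norm `ℓ` (`isPrincipal_of_absNorm_eq_prime_sq`), `N = ℓ³` gives `P = (ℓ)`.
[cite: Marcus1977, Ch. 5 Thm. 35–37 and Cor. 2] -/
theorem classNumber_eq_one_of_prime_norm_principal (h3 : Module.finrank ℚ K = 3) {B : ℕ}
    (hM : (4 / π) ^ NumberField.InfinitePlace.nrComplexPlaces K *
      ((Module.finrank ℚ K).factorial / (Module.finrank ℚ K : ℝ) ^ Module.finrank ℚ K * √|(NumberField.discr K : ℝ)|) < B)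
    (hone : ∀ ℓ : ℕ, ℓ < B → ℓ.Prime → ∀ J : Ideal (𝓞 K), Ideal.absNorm J = ℓ → ∃ α : 𝓞 K, J = Ideal.span {α}) :
    NumberField.classNumber K = 1 := by
  rw [NumberField.classNumber_eq_one_iff]
  refine RingOfIntegers.isPrincipalIdealRing_of_isPrincipal_of_norm_le_of_isPrime fun I hI hle ↦ ?_
  have hlt : Ideal.absNorm (I : Ideal (𝓞 K)) < B := by exact_mod_cast hle.trans_lt hM
  have hI0 : (I : Ideal (𝓞 K)) ≠ ⊥ := nonZeroDivisors.coe_ne_zero I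
  obtain ⟨ℓ, hℓ, hℓI, i, hi1, hi3, hN⟩ := exists_prime_natCast_mem K h3 hI hI0
  have hℓB : ℓ < B := by
    refine lt_of_le_of_lt ?_ hlt
    rw [hN]
    exact Nat.le_self_pow (by omega) ℓ
  interval_cases i
  · rw [pow_one] at hN
    obtain ⟨α, hα⟩ := hone ℓ hℓB hℓ _ hN
    exact ⟨⟨α, by rw [hα]⟩⟩
  · obtain ⟨β, hβ⟩ := isPrincipal_of_absNorm_eq_prime_sq K h3 hℓ (hone ℓ hℓB hℓ) hℓI hN
    exact ⟨⟨β, by rw [hβ]⟩⟩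
  · have hnorm : (Algebra.norm ℤ ((ℓ : ℕ) : 𝓞 K)).natAbs = ℓ ^ 3 := by
      have : ((ℓ : ℕ) : 𝓞 K) = algebraMap ℤ (𝓞 K) ℓ := by simp
      rw [this, Algebra.norm_algebraMap, NumberField.RingOfIntegers.rank, h3, Int.natAbs_pow]
      simp
    exact ⟨⟨_, by rw [eq_span_singleton_of_mem_of_absNorm_eq K (pow_ne_zero 3 hℓ.ne_zero) hN hℓI hnorm]⟩⟩

/-! ## §2 Elements of `𝓞 K` with a denominator -/

/-- **An algebraic integer `ω` with `m ω = x + yθ + zθ²`**, from the scaled cubic identity `T³ + (m c₂) T² + (m² c₁) T + m³ c₀ = 0` for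
`T = x + yθ + zθ²` (`m ≠ 0`): `ω = T/m` is a root of the monic `X³ + c₂X² + c₁X + c₀ ∈ ℤ[X]`, hence integral. This is how the per-field
certificates present elements of `𝓞 K ∖ ℤ[θ]` (second generators, fractional witnesses). [cite: Marcus1977, Ch. 2 Thm. 2 and Cor. 2] -/
theorem exists_intElem_of_scaled_cubic (b : 𝓞 K) (x y z : ℤ) {m : ℕ} (hm : m ≠ 0) (c₂ c₁ c₀ : ℤ)
    (hid : ((x : 𝓞 K) + y * b + z * b ^ 2) ^ 3 + (m * c₂ : ℤ) * ((x : 𝓞 K) + y * b + z * b ^ 2) ^ 2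
      + (m ^ 2 * c₁ : ℤ) * ((x : 𝓞 K) + y * b + z * b ^ 2) + (m ^ 3 * c₀ : ℤ) = 0) :
    ∃ ω : 𝓞 K, (m : 𝓞 K) * ω = (x : 𝓞 K) + y * b + z * b ^ 2 ∧ ω ^ 3 + c₂ * ω ^ 2 + c₁ * ω + c₀ = 0 := by
  set T : 𝓞 K := (x : 𝓞 K) + y * b + z * b ^ 2 with hT
  have hmK : (m : K) ≠ 0 := by exact_mod_cast hm
  set t : K := (T : K) / m with ht
  have hTK : ((T : 𝓞 K) : K) ^ 3 + ((m : K) * c₂) * ((T : 𝓞 K) : K) ^ 2 + ((m : K) ^ 2 * c₁) * ((T : 𝓞 K) : K) + (m : K) ^ 3 * c₀ = 0 := by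
    have := congrArg (algebraMap (𝓞 K) K) hid
    simp only [map_add, map_mul, map_pow, map_intCast, map_zero] at this
    push_cast at this
    linear_combination this
  have htroot : t ^ 3 + (c₂ : K) * t ^ 2 + (c₁ : K) * t + (c₀ : K) = 0 := by
    have hTt : ((T : 𝓞 K) : K) = (m : K) * t := by rw [ht]; field_simp
    rw [hTt] at hTK
    have h3 : (m : K) ^ 3 ≠ 0 := pow_ne_zero 3 hmK
    apply (mul_right_injective₀ h3)
    simp only [mul_zero]
    linear_combination hTK
  have hint : IsIntegral ℤ t := by
    refine Literature.NumberTheory.NumberFields.MonicCubic.isIntegral_of_aeval (a := c₂) (b := c₁) (c := c₀) ?_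
    simp only [Literature.NumberTheory.NumberFields.MonicCubic.poly, map_add, map_mul, map_pow, aeval_X, eq_intCast,
      map_intCast]
    exact htroot
  refine ⟨⟨t, hint⟩, ?_, ?_⟩
  · apply Subtype.ext
    show (m : K) * t = (T : K)
    rw [ht]; field_simp
  · apply Subtype.ext
    show t ^ 3 + (c₂ : K) * t ^ 2 + (c₁ : K) * t + (c₀ : K) = 0
    exact htroot

/-! ## §3 Ideals of prime norm from fractional witnesses -/

/-- **An ideal of prime norm `ℓ` is principal, given FRACTIONAL norm-`ℓ` witnesses**: for each root `a` of the cubic mod `ℓ` integers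
`x, y, z`, `m` coprime to `ℓ` with `ℓ ∣ x + ya + za²`, an `ω ∈ 𝓞 K` with `m ω = x + yθ + zθ²`, and `|normPoly(x, y, z)| = m³ ℓ`. Then
`x + yθ + zθ² ∈ I`, `I` is prime (its norm is), `m ∉ I` (else `ℓ ∣ m³`), so `ω ∈ I`; and `N(ω) = ± ℓ` since `N(mω) = m³ N(ω)`.
[cite: Marcus1977, Ch. 5 Thm. 37 and the worked examples after Cor. 2] [cite: Cohen1993, §4.8.2, §6.3] -/
theorem isPrincipal_of_absNorm_eq_prime_frac (h3 : Module.finrank ℚ K = 3) (b : 𝓞 K) {p q r : ℤ}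
    (hirr : Irreducible (Cubic.toPoly ⟨1, (p : ℚ), q, r⟩)) (hb : b ^ 3 + p * b ^ 2 + q * b + r = 0)
    {ℓ : ℕ} (hℓ : ℓ.Prime)
    (hcert : ∀ a : ℕ, a < ℓ → (ℓ : ℤ) ∣ (a : ℤ) ^ 3 + p * (a : ℤ) ^ 2 + q * a + r →
      ∃ x y z : ℤ, ∃ m : ℕ, Nat.Coprime m ℓ ∧ (ℓ : ℤ) ∣ x + y * a + z * (a : ℤ) ^ 2 ∧
        (∃ ω : 𝓞 K, (m : 𝓞 K) * ω = (x : 𝓞 K) + y * b + z * b ^ 2) ∧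
        (x ^ 3 - p * x ^ 2 * y + (p ^ 2 - 2 * q) * x ^ 2 * z + q * x * y ^ 2 + (3 * r - p * q) * x * y * z
          + (q ^ 2 - 2 * p * r) * x * z ^ 2 - r * y ^ 3 + p * r * y ^ 2 * z - q * r * y * z ^ 2 + r ^ 2 * z ^ 3).natAbs = m ^ 3 * ℓ)
    {I : Ideal (𝓞 K)} (hI : Ideal.absNorm I = ℓ) : ∃ α : 𝓞 K, I = Ideal.span {α} := by
  have hℓI : ((ℓ : ℕ) : 𝓞 K) ∈ I := by have := Ideal.absNorm_mem I; rwa [hI] at this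
  have hIprime : I.IsPrime := Ideal.isPrime_of_irreducible_absNorm (by rw [hI]; exact hℓ)
  obtain ⟨a, ha, hab⟩ := exists_sub_natCast_mem_of_absNorm_eq_prime K hℓ hI b
  have hroot := natCast_dvd_of_sub_mem K hℓ hI h3 hb hab
  obtain ⟨x, y, z, m, hcop, hdvd, ⟨ω, hω⟩, hN⟩ := hcert a ha hroot
  have hTI : ((x : 𝓞 K) + y * b + z * b ^ 2) ∈ I := coords_mem_of_dvd K hℓI hab hdvd
  have hm0 : m ≠ 0 := by
    rintro rfl
    rw [Nat.coprime_zero_left] at hcop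
    exact hℓ.one_lt.ne' hcop
  -- `m ∉ I`
  have hmI : ((m : ℕ) : 𝓞 K) ∉ I := by
    intro hmem
    have hd := absNorm_dvd_pow_three_of_natCast_mem K h3 hmem
    rw [hI] at hd
    have : ℓ ∣ m := hℓ.dvd_of_dvd_pow hd
    exact hℓ.one_lt.ne' ((Nat.coprime_self ℓ).mp (Nat.Coprime.coprime_dvd_left this hcop))
  have hωI : ω ∈ I := by
    have : ((m : ℕ) : 𝓞 K) * ω ∈ I := by rw [hω]; exact hTI
    exact (hIprime.mem_or_mem this).resolve_left hmI
  -- the norm of `ω`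
  have hnormT := natAbs_norm_coords_eq_natAbs_normPoly K h3 b hirr hb x y z
  rw [hN, ← hω, map_mul, Int.natAbs_mul] at hnormT
  have hnm : (Algebra.norm ℤ ((m : ℕ) : 𝓞 K)).natAbs = m ^ 3 := by
    have : ((m : ℕ) : 𝓞 K) = algebraMap ℤ (𝓞 K) m := by simp
    rw [this, Algebra.norm_algebraMap, NumberField.RingOfIntegers.rank, h3, Int.natAbs_pow]
    simp
  rw [hnm] at hnormT
  have hNω : (Algebra.norm ℤ ω).natAbs = ℓ := Nat.eq_of_mul_eq_mul_left (pow_pos (Nat.pos_of_ne_zero hm0) 3) hnormT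
  exact ⟨ω, eq_span_singleton_of_mem_of_absNorm_eq K hℓ.ne_zero hI hωI hNω⟩


/-! ## §4 The index-sharpened discriminant bound -/

/-- **`k² · |d_K| ≤ |disc|` when the index `[𝓞 K : ℤ[θ]]` is divisible by the prime `k`**, witnessed by an algebraic integer
`ω = (x + yθ + zθ²)/k` with `(x, y, z) ≢ 0 (mod k)`: in the proof of `exists_sq_mul_discr_eq` (`disc = det(P)² · d_K`, `P` the
integer matrix of `1, θ, θ²` in an integral basis) the row vector `(x, y, z) mod k` is a non-zero element of the left kernel of
`P mod k`, so `k ∣ det P`. Sharpens the Minkowski bound of the certificates by the factor `k`.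
[cite: Marcus1977, Ch. 2 Exercise 27 (disc(α₁..αₙ) = [𝓞:ℤ[α]]² · disc) and Thm. 13] -/
theorem sq_mul_abs_discr_le_abs_cubic_discr (h3 : Module.finrank ℚ K = 3) (b : 𝓞 K) {p q r : ℤ}
    (hirr : Irreducible (Cubic.toPoly ⟨1, (p : ℚ), q, r⟩)) (hb : b ^ 3 + p * b ^ 2 + q * b + r = 0)
    {k : ℕ} (hk : k.Prime) (x y z : ℤ) (hω : ∃ ω : 𝓞 K, (k : 𝓞 K) * ω = (x : 𝓞 K) + y * b + z * b ^ 2)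
    (hnd : ¬ ((k : ℤ) ∣ x ∧ (k : ℤ) ∣ y ∧ (k : ℤ) ∣ z)) :
    ((k : ℤ) ^ 2) * |NumberField.discr K| ≤ |Cubic.discr ⟨1, p, q, r⟩| := by
  set θ : K := (b : K) with hθdef
  have hfm : (Cubic.toPoly ⟨1, (p : ℚ), q, r⟩).Monic := Cubic.monic_of_a_eq_one'
  have hθK : θ ^ 3 + (p : K) * θ ^ 2 + (q : K) * θ + (r : K) = 0 := by
    have := congrArg (algebraMap (𝓞 K) K) hb
    simpa [hθdef] using this
  have hθQ : θ ^ 3 + ((p : ℚ) : K) * θ ^ 2 + ((q : ℚ) : K) * θ + ((r : ℚ) : K) = 0 := by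
    push_cast; exact hθK
  have hxroot : aeval θ (Cubic.toPoly ⟨1, (p : ℚ), q, r⟩) = 0 := by
    simp only [Cubic.toPoly, map_one, one_mul, aeval_add, aeval_mul, aeval_C, aeval_X_pow, aeval_X,
      eq_ratCast, Rat.cast_intCast]
    exact hθK
  have hint : IsIntegral ℚ θ := ⟨_, hfm, by rwa [← aeval_def]⟩
  have hmin : minpoly ℚ θ = Cubic.toPoly ⟨1, (p : ℚ), q, r⟩ := (minpoly.eq_of_irreducible_of_monic hirr hxroot hfm).symm
  have hnd3 : (minpoly ℚ θ).natDegree = 3 := by rw [hmin]; exact Cubic.natDegree_of_a_ne_zero' one_ne_zero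
  have hli : LinearIndependent ℚ fun i : Fin 3 => θ ^ (i : ℕ) := by
    have hcomp : (fun i : Fin 3 => θ ^ (i : ℕ)) ∘ (finCongr hnd3) =
        fun i : Fin (minpoly ℚ θ).natDegree => θ ^ (i : ℕ) := by
      funext i; simp
    have h0 : LinearIndependent ℚ fun i : Fin (minpoly ℚ θ).natDegree => θ ^ (i : ℕ) := linearIndependent_pow θ
    rw [← hcomp] at h0
    exact (linearIndependent_equiv (finCongr hnd3)).mp h0
  let b3 : Module.Basis (Fin 3) ℚ K := basisOfLinearIndependentOfCardEqFinrank hli (by simp [h3])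
  have hb3 : ∀ i, b3 i = θ ^ (i : ℕ) := fun i => by
    simp [b3, coe_basisOfLinearIndependentOfCardEqFinrank]
  have hdisc : Algebra.discr ℚ ⇑b3 = Cubic.discr ⟨1, (p : ℚ), q, r⟩ := discr_powers_eq_cubic_discr θ b3 hb3 hθQ
  have hcard : Fintype.card (Module.Free.ChooseBasisIndex ℤ (𝓞 K)) = 3 := by
    rw [← Module.finrank_eq_card_chooseBasisIndex, RingOfIntegers.rank, h3]
  let e : Module.Free.ChooseBasisIndex ℤ (𝓞 K) ≃ Fin 3 := Fintype.equivFinOfCardEq hcard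
  let B3 : Module.Basis (Fin 3) ℤ (𝓞 K) := (RingOfIntegers.basis K).reindex e
  let I3 : Module.Basis (Fin 3) ℚ K := (integralBasis K).reindex e
  have hI3 : ∀ j, I3 j = algebraMap (𝓞 K) K (B3 j) := fun j => by
    simp [I3, B3, integralBasis_apply]
  have hdI : Algebra.discr ℚ ⇑I3 = NumberField.discr K := by
    simp only [I3, Module.Basis.coe_reindex, Algebra.discr_reindex, coe_discr]
  let P : Matrix (Fin 3) (Fin 3) ℤ := Matrix.of fun i j => B3.repr (b ^ (i : ℕ)) j
  have hP : ∀ i j, P i j = B3.repr (b ^ (i : ℕ)) j := fun i j => rfl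
  have hvec : ⇑b3 = (P.map (Int.cast : ℤ → ℚ)).map (algebraMap ℚ K) *ᵥ ⇑I3 := by
    funext i
    rw [hb3, Matrix.mulVec, dotProduct]
    have hsum := B3.sum_repr (b ^ (i : ℕ))
    have := congrArg (algebraMap (𝓞 K) K) hsum
    rw [map_sum] at this
    rw [hθdef, ← map_pow, ← this]
    refine Finset.sum_congr rfl fun j _ => ?_
    rw [hI3, Matrix.map_apply, Matrix.map_apply, hP, map_zsmul, zsmul_eq_mul, map_intCast]
  have key := Algebra.discr_of_matrix_mulVec ⇑I3 (P.map (Int.cast : ℤ → ℚ))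
  rw [← hvec, hdisc, hdI] at key
  have hdet : (P.map (Int.cast : ℤ → ℚ)).det = ((P.det : ℤ) : ℚ) := by
    have := RingHom.map_det (Int.castRingHom ℚ) P
    rw [RingHom.mapMatrix_apply, Int.coe_castRingHom] at this
    exact this.symm
  rw [hdet] at key
  have hQ : Cubic.discr ⟨1, (p : ℚ), q, r⟩ = ((Cubic.discr ⟨1, p, q, r⟩ : ℤ) : ℚ) := by
    simp only [Cubic.discr]; push_cast; ring
  rw [hQ] at key
  have keyZ : Cubic.discr ⟨1, p, q, r⟩ = P.det ^ 2 * NumberField.discr K := by exact_mod_cast key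
  -- `k ∣ det P`: `(x, y, z) mod k` is in the left kernel of `P mod k`
  have hdiv : (k : ℤ) ∣ P.det := by
    obtain ⟨ω, hω⟩ := hω
    have hT : (x : 𝓞 K) + y * b + z * b ^ 2 = x • b ^ ((0 : Fin 3) : ℕ) + y • b ^ ((1 : Fin 3) : ℕ) + z • b ^ ((2 : Fin 3) : ℕ) := by
      simp [zsmul_eq_mul]
    have hcoord : ∀ j, (k : ℤ) ∣ x * P 0 j + y * P 1 j + z * P 2 j := by
      intro j
      have h1 : B3.repr ((x : 𝓞 K) + y * b + z * b ^ 2) j = x * P 0 j + y * P 1 j + z * P 2 j := by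
        rw [hT, map_add, map_add, map_zsmul, map_zsmul, map_zsmul, Finsupp.add_apply, Finsupp.add_apply,
          Finsupp.smul_apply, Finsupp.smul_apply, Finsupp.smul_apply, smul_eq_mul, smul_eq_mul, smul_eq_mul, hP, hP, hP]
      have h2 : B3.repr ((x : 𝓞 K) + y * b + z * b ^ 2) j = (k : ℤ) * B3.repr ω j := by
        rw [← hω, show ((k : ℕ) : 𝓞 K) * ω = (k : ℤ) • ω by simp [zsmul_eq_mul], map_zsmul, Finsupp.smul_apply,
          smul_eq_mul]
      rw [← h1, h2]
      exact Dvd.intro _ rfl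
    haveI : Fact k.Prime := ⟨hk⟩
    set v : Fin 3 → ZMod k := ![(x : ZMod k), (y : ZMod k), (z : ZMod k)] with hv
    have hv0 : v ≠ 0 := by
      intro h0
      apply hnd
      have h0' : ∀ i, v i = 0 := fun i => by rw [h0]; rfl
      refine ⟨?_, ?_, ?_⟩
      · exact (ZMod.intCast_zmod_eq_zero_iff_dvd x k).mp (by simpa [hv] using h0' 0)
      · exact (ZMod.intCast_zmod_eq_zero_iff_dvd y k).mp (by simpa [hv] using h0' 1)
      · exact (ZMod.intCast_zmod_eq_zero_iff_dvd z k).mp (by simpa [hv] using h0' 2)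
    have hvP : v ᵥ* ((Int.castRingHom (ZMod k)).mapMatrix P) = 0 := by
      funext j
      rw [Matrix.vecMul, dotProduct, Fin.sum_univ_three]
      simp only [hv, RingHom.mapMatrix_apply, Matrix.map_apply, eq_intCast, Matrix.cons_val_zero, Matrix.cons_val_one,
        Matrix.cons_val_two, Matrix.tail_cons, Matrix.head_cons, Pi.zero_apply]
      obtain ⟨c, hc⟩ := hcoord j
      have := congrArg (Int.cast : ℤ → ZMod k) hc
      push_cast at this
      rw [this, ZMod.natCast_self, zero_mul]
    have hdet0 : ((Int.castRingHom (ZMod k)).mapMatrix P).det = 0 :=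
      Matrix.exists_vecMul_eq_zero_iff.mp ⟨v, hv0, hvP⟩
    rw [← RingHom.map_det] at hdet0
    exact (ZMod.intCast_zmod_eq_zero_iff_dvd _ k).mp hdet0
  obtain ⟨m', hm'⟩ := hdiv
  have hm'0 : m' ≠ 0 := by
    rintro rfl
    rw [mul_zero] at hm'
    have hne := Algebra.discr_not_zero_of_basis ℚ b3
    rw [hdisc, hQ, keyZ, hm'] at hne
    simp at hne
  have hm1 : (1 : ℤ) ≤ |m'| ^ 2 := by have := Int.one_le_abs hm'0; nlinarith
  have hk' : |(k : ℤ)| = k := abs_of_nonneg (by positivity)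
  rw [keyZ, hm', abs_mul, abs_pow, abs_mul, hk', mul_pow]
  nlinarith [hm1, mul_nonneg (sq_nonneg (k : ℤ)) (abs_nonneg (NumberField.discr K))]

/-- **`|d_K| ≤ D` from the index-sharpened bound**: if `k² · |d_K| ≤ |disc|` and `|disc| ≤ k² D` then `|d_K| ≤ D`. [folklore] -/
theorem abs_discr_le_of_sq_mul_le {k : ℕ} (hk : k ≠ 0) {D : ℕ} {disc : ℤ}
    (h : ((k : ℤ) ^ 2) * |NumberField.discr K| ≤ |disc|) (hD : |disc| ≤ (k : ℤ) ^ 2 * D) :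
    |NumberField.discr K| ≤ D := by
  have hk2 : (0 : ℤ) < (k : ℤ) ^ 2 := by positivity
  nlinarith


end Summit.BirchSwinnertonDyer.BirchSwinnertonDyer.Theorems.AddKatoTwo

end
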